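import Summits.KontsevichZagierPeriods.KontsevichZagierPeriods.Theorems.RootDecompRelativeModAbsoluteCircleLogP10

/-! # `RootDecompRelativeModAbsoluteCircleLogP11` — part 11/11 of the mechanical ≤400-line split of `CircleLogTranscendence_landing.lean` (sha256 022159109aaffa3a…)
Source: decomp-kz lens-3 g13 `CircleLogTranscendence_v9.lean` (HOME/decomp-kz-lens-3/g13/, sha256 afb45a43…; critic g5-45/60/65/68/69 CLEARED FOR LANDING --supports 30572 (§4 defs, §8–§10 CircleLogStructureAt 0 from the tree's baker_decomposition_complex, constant-data cells every n, §16–§23 descent ingredients); landed by census-1 g9 over the landed CylLogSplitP52 (BLOCK G13): the duplicate def CircleLogStructure is dropped in favour of the landed one).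
Split by census-1 g9 `gen/splitlean.py`: scopes re-opened with their `open`/`variable`/`set_option` context; mathematics and declaration order unchanged. -/

noncomputable section
open Set MeasureTheory Filter Topology
open scoped BigOperators
open Literature.NumberTheory.Transcendental Literature.ModelTheory.ExponentialFields
namespace Summit.KontsevichZagierPeriods.RootDecompRelativeModAbsolute.Rung30571.RegularisedLogLayer.CylLog.Leaf
namespace G13

/-- Exact twin of §18: projectively constant coefficients ⇒ EXACT structure. -/
theorem circleStructExact_projConstCoeff {n k l : ℕ} {U : Set (Fin n → ℝ)} (hU : IsSemialgebraic ℚ U) (hUo : IsOpen U)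
    {h W : Fin k → (Fin n → ℝ) → ℝ} {p u : Fin l → (Fin n → ℝ) → ℝ} {g : (Fin n → ℝ) → ℝ}
    (hh : ∀ i, IsSemialgebraicFunOn ℚ U (h i)) (hW : ∀ i, IsSemialgebraicFunOn ℚ U (W i))
    (hWc : ∀ i, ContinuousOn (W i) U) (hW0 : ∀ i, ∀ x ∈ U, 0 < W i x)
    (hp : ∀ j, IsSemialgebraicFunOn ℚ U (p j)) (hu : ∀ j, IsSemialgebraicFunOn ℚ U (u j))
    (huc : ∀ j, ContinuousOn (u j) U) (hg : IsSemialgebraicFunOn ℚ U g)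
    {φ : (Fin n → ℝ) → ℝ} (hφ : IsSemialgebraicFunOn ℚ U φ) (hφ0 : ∀ x ∈ U, φ x ≠ 0)
    (c : Fin k → ℝ) (d : Fin l → ℝ) (hhφ : ∀ i, ∀ x ∈ U, h i x = φ x * c i) (hpφ : ∀ j, ∀ x ∈ U, p j x = φ x * d j)
    (hid : ∀ x ∈ U, ∑ i, h i x * Real.log (W i x) + ∑ j, p j x * Real.arctan (u j x) = g x) :
    CircleStructExactOn k l U h W p u g := by
  classical
  have hh' : ∀ i, IsSemialgebraicFunOn ℚ U (fun x => h i x / φ x) := fun i => (hh i).div hφ hφ0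
  have hp' : ∀ j, IsSemialgebraicFunOn ℚ U (fun x => p j x / φ x) := fun j => (hp j).div hφ hφ0
  have hg' : IsSemialgebraicFunOn ℚ U (fun x => g x / φ x) := hg.div hφ hφ0
  have hhc : ∀ i, ∀ x ∈ U, ∀ y ∈ U, h i x / φ x = h i y / φ y := fun i x hx y hy => by
    rw [hhφ i x hx, hhφ i y hy, mul_div_cancel_left₀ _ (hφ0 x hx), mul_div_cancel_left₀ _ (hφ0 y hy)]
  have hpc : ∀ j, ∀ x ∈ U, ∀ y ∈ U, p j x / φ x = p j y / φ y := fun j x hx y hy => by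
    rw [hpφ j x hx, hpφ j y hy, mul_div_cancel_left₀ _ (hφ0 x hx), mul_div_cancel_left₀ _ (hφ0 y hy)]
  have hid' : ∀ x ∈ U, ∑ i, h i x / φ x * Real.log (W i x) + ∑ j, p j x / φ x * Real.arctan (u j x) =
      g x / φ x := by
    intro x hx
    rw [← hid x hx, add_div, Finset.sum_div, Finset.sum_div]
    congr 1
    · exact Finset.sum_congr rfl fun i _ => by ring
    · exact Finset.sum_congr rfl fun j _ => by ring
  obtain ⟨N, C, hC, hdisj, hnull, hcell⟩ :=
    circleStructExact_constCoeff hU hUo hh' hW hWc hW0 hp' hu huc hg' hhc hpc hid'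
  refine ⟨N, C, hC, hdisj, hnull, fun c₀ => ?_⟩
  obtain ⟨hg0, R, f, q, S, f', q', hq, hrel, hhq, hq', hrel', hpq⟩ := hcell c₀
  have hCU : C c₀ ⊆ U := (hC c₀).2.2
  have hφC : IsSemialgebraicFunOn ℚ (C c₀) φ := hφ.mono hCU (hC c₀).1
  refine ⟨fun x hx => ?_, R, f, fun r x => φ x * q r x, S, f', fun s x => φ x * q' s x, fun r => ?_, hrel,
    fun i x hx => ?_, fun s => ?_, hrel', fun j x hx => ?_⟩
  · have := hg0 x hx
    rcases div_eq_zero_iff.mp this with h0 | h0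
    · exact h0
    · exact absurd h0 (hφ0 x (hCU hx))
  · exact (IsSemialgebraicFunOn.mul_holds hφC (hq r)).congr fun x _ => by simp only [Pi.mul_apply]
  · have e := hhq i x hx
    rw [div_eq_iff (hφ0 x (hCU hx))] at e
    rw [e, Finset.sum_mul]
    exact Finset.sum_congr rfl fun r _ => by ring
  · exact (IsSemialgebraicFunOn.mul_holds hφC (hq' s)).congr fun x _ => by simp only [Pi.mul_apply]
  · have e := hpq j x hx
    rw [div_eq_iff (hφ0 x (hCU hx))] at e
    rw [e, Finset.sum_mul]
    exact Finset.sum_congr rfl fun s _ => by ring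

/-- Exact twin of §19: localisation along an a.e. open sa partition. -/
theorem circleStructExact_of_cells {n k l : ℕ} {U G : Set (Fin n → ℝ)} (hGU : G ⊆ U) (hUG : volume (U \ G) = 0)
    {h W : Fin k → (Fin n → ℝ) → ℝ} {p u : Fin l → (Fin n → ℝ) → ℝ} {g : (Fin n → ℝ) → ℝ}
    {B : ℕ} (T : Fin B → Set (Fin n → ℝ)) (hTG : ∀ b, T b ⊆ G) (hTd : Pairwise (Function.onFun Disjoint T))
    (hTn : volume (G \ ⋃ b, T b) = 0) (hcell : ∀ b, CircleStructExactOn k l (T b) h W p u g) :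
    CircleStructExactOn k l U h W p u g := by
  classical
  choose N C hC hCd hCn hdata using hcell
  obtain ⟨M, E, hE, hEd, hEn⟩ := exists_flatten_partition T hTG hTd hTn N C
    (fun b c => (hC b c).2.2) hCd hCn
    (P := fun S => IsSemialgebraic ℚ S ∧ IsOpen S ∧ ((∀ x ∈ S, g x = 0) ∧
        ∃ (R : ℕ) (f : Fin R → Fin k → ℤ) (q : Fin R → (Fin n → ℝ) → ℝ)
          (S' : ℕ) (f' : Fin S' → Fin l → ℤ) (q' : Fin S' → (Fin n → ℝ) → ℝ),
          (∀ r, IsSemialgebraicFunOn ℚ S (q r)) ∧ (∀ r, ∀ x ∈ S, ∏ i, W i x ^ (f r i) = 1) ∧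
          (∀ i, ∀ x ∈ S, h i x = ∑ r, q r x * (f r i : ℝ)) ∧
          (∀ s, IsSemialgebraicFunOn ℚ S (q' s)) ∧
          (∀ s, ∀ x ∈ S, ∑ j, (f' s j : ℝ) * Real.arctan (u j x) = 0) ∧
          (∀ j, ∀ x ∈ S, p j x = ∑ s, q' s x * (f' s j : ℝ))))
    (fun b c => ⟨(hC b c).1, (hC b c).2.1, hdata b c⟩)
  refine ⟨M, E, fun j => ⟨(hE j).2.1, (hE j).2.2.1, (hE j).1.trans hGU⟩, hEd, ?_, fun j => (hE j).2.2.2⟩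
  exact measure_mono_null (fun x hx => by
    by_cases hxG : x ∈ G
    · exact Or.inr ⟨hxG, hx.2⟩
    · exact Or.inl ⟨hx.1, hxG⟩) (measure_union_null hUG hEn)

/-- Exact twin of §21 (log): translating EXACT structure data back after eliminating a log term by an exact relation. -/
theorem circleStructExact_elimLog {n k l : ℕ} {U : Set (Fin n → ℝ)}
    {h W : Fin k → (Fin n → ℝ) → ℝ} {p u : Fin l → (Fin n → ℝ) → ℝ} {g : (Fin n → ℝ) → ℝ}
    (hh : ∀ i, IsSemialgebraicFunOn ℚ U (h i)) (f₀ : Fin k → ℤ) (i₀ : Fin k) (hf₀ : f₀ i₀ ≠ 0)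
    (hrel₀ : ∀ x ∈ U, ∏ i, W i x ^ (f₀ i) = 1)
    (hred : CircleStructExactOn k l U (fun i x => h i x - h i₀ x * ((f₀ i : ℝ) / (f₀ i₀ : ℝ))) W p u g) :
    CircleStructExactOn k l U h W p u g := by
  classical
  obtain ⟨N, C, hC, hdisj, hnull, hcell⟩ := hred
  refine ⟨N, C, hC, hdisj, hnull, fun c₀ => ?_⟩
  obtain ⟨hg0, R, f, q, S, f', q', hq, hrel, hhq, hq', hrel', hpq⟩ := hcell c₀
  have hCU : C c₀ ⊆ U := (hC c₀).2.2
  have hq₀ : IsSemialgebraicFunOn ℚ (C c₀) (fun x => h i₀ x / (f₀ i₀ : ℝ)) := by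
    have h1 : IsSemialgebraicFunOn ℚ (C c₀) (h i₀) := (hh i₀).mono hCU (hC c₀).1
    have h2 : IsSemialgebraicFunOn ℚ (C c₀) (fun _ => ((f₀ i₀ : ℚ) : ℝ)) :=
      isSemialgebraicFunOn_const_ratCast (hC c₀).1 (f₀ i₀ : ℚ)
    have h3 := h1.div h2 (fun x _ => by exact_mod_cast hf₀)
    exact h3.congr fun x _ => by push_cast; rfl
  refine ⟨hg0, R + 1, Fin.snoc f f₀, Fin.snoc q (fun x => h i₀ x / (f₀ i₀ : ℝ)), S, f', q', ?_, ?_, ?_, hq',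
    hrel', hpq⟩
  · intro r
    refine Fin.lastCases ?_ (fun r' => ?_) r
    · simpa only [Fin.snoc_last] using hq₀
    · simpa only [Fin.snoc_castSucc] using hq r'
  · intro r x hx
    refine Fin.lastCases ?_ (fun r' => ?_) r
    · simpa only [Fin.snoc_last] using hrel₀ x (hCU hx)
    · simpa only [Fin.snoc_castSucc] using hrel r' x hx
  · intro i x hx
    rw [Fin.sum_univ_castSucc]
    simp only [Fin.snoc_castSucc, Fin.snoc_last]
    have e := hhq i x hx
    have hf0 : (f₀ i₀ : ℝ) ≠ 0 := by exact_mod_cast hf₀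
    have : h i x = ∑ r, q r x * (f r i : ℝ) + h i₀ x * ((f₀ i : ℝ) / (f₀ i₀ : ℝ)) := by rw [← e]; ring
    rw [this]
    congr 1
    field_simp

/-- Exact twin of §21 (angle): translating EXACT structure data back after eliminating an angle term by an exact relation. -/
theorem circleStructExact_elimAngle {n k l : ℕ} {U : Set (Fin n → ℝ)}
    {h W : Fin k → (Fin n → ℝ) → ℝ} {p u : Fin l → (Fin n → ℝ) → ℝ} {g : (Fin n → ℝ) → ℝ}
    (hp : ∀ j, IsSemialgebraicFunOn ℚ U (p j)) (f₀ : Fin l → ℤ) (j₀ : Fin l) (hf₀ : f₀ j₀ ≠ 0)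
    (hrel₀ : ∀ x ∈ U, ∑ j, (f₀ j : ℝ) * Real.arctan (u j x) = 0)
    (hred : CircleStructExactOn k l U h W (fun j x => p j x - p j₀ x * ((f₀ j : ℝ) / (f₀ j₀ : ℝ))) u g) :
    CircleStructExactOn k l U h W p u g := by
  classical
  obtain ⟨N, C, hC, hdisj, hnull, hcell⟩ := hred
  refine ⟨N, C, hC, hdisj, hnull, fun c₀ => ?_⟩
  obtain ⟨hg0, R, f, q, S, f', q', hq, hrel, hhq, hq', hrel', hpq⟩ := hcell c₀
  have hCU : C c₀ ⊆ U := (hC c₀).2.2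
  have hq₀ : IsSemialgebraicFunOn ℚ (C c₀) (fun x => p j₀ x / (f₀ j₀ : ℝ)) := by
    have h1 : IsSemialgebraicFunOn ℚ (C c₀) (p j₀) := (hp j₀).mono hCU (hC c₀).1
    have h2 : IsSemialgebraicFunOn ℚ (C c₀) (fun _ => ((f₀ j₀ : ℚ) : ℝ)) :=
      isSemialgebraicFunOn_const_ratCast (hC c₀).1 (f₀ j₀ : ℚ)
    have h3 := h1.div h2 (fun x _ => by exact_mod_cast hf₀)
    exact h3.congr fun x _ => by push_cast; rfl
  refine ⟨hg0, R, f, q, S + 1, Fin.snoc f' f₀, Fin.snoc q' (fun x => p j₀ x / (f₀ j₀ : ℝ)), hq, hrel, hhq,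
    ?_, ?_, ?_⟩
  · intro s
    refine Fin.lastCases ?_ (fun s' => ?_) s
    · simpa only [Fin.snoc_last] using hq₀
    · simpa only [Fin.snoc_castSucc] using hq' s'
  · intro s x hx
    refine Fin.lastCases ?_ (fun s' => ?_) s
    · simpa only [Fin.snoc_last] using hrel₀ x (hCU hx)
    · simpa only [Fin.snoc_castSucc] using hrel' s' x hx
  · intro j x hx
    rw [Fin.sum_univ_castSucc]
    simp only [Fin.snoc_castSucc, Fin.snoc_last]
    have e := hpq j x hx
    have hf0 : (f₀ j₀ : ℝ) ≠ 0 := by exact_mod_cast hf₀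
    have : p j x = ∑ s, q' s x * (f' s j : ℝ) + p j₀ x * ((f₀ j : ℝ) / (f₀ j₀ : ℝ)) := by rw [← e]; ring
    rw [this]
    congr 1
    field_simp

/-- Exact twin of §22 (log): dropping a log index with vanishing coefficient. -/
theorem circleStructExact_dropLog {n k l : ℕ} {U : Set (Fin n → ℝ)}
    {h W : Fin (k + 1) → (Fin n → ℝ) → ℝ} {p u : Fin l → (Fin n → ℝ) → ℝ} {g : (Fin n → ℝ) → ℝ}
    (i₀ : Fin (k + 1)) (hzero : ∀ x ∈ U, h i₀ x = 0)
    (hred : CircleStructExactOn k l U (fun i => h (i₀.succAbove i)) (fun i => W (i₀.succAbove i)) p u g) :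
    CircleStructExactOn (k + 1) l U h W p u g := by
  classical
  obtain ⟨N, C, hC, hdisj, hnull, hcell⟩ := hred
  refine ⟨N, C, hC, hdisj, hnull, fun c₀ => ?_⟩
  obtain ⟨hg0, R, f, q, S, f', q', hq, hrel, hhq, hq', hrel', hpq⟩ := hcell c₀
  have hCU : C c₀ ⊆ U := (hC c₀).2.2
  refine ⟨hg0, R, fun r => Fin.insertNth i₀ (0 : ℤ) (f r), q, S, f', q', hq, ?_, ?_, hq', hrel', hpq⟩
  · intro r x hx
    rw [Fin.prod_univ_succAbove _ i₀]
    simp only [Fin.insertNth_apply_same, Fin.insertNth_apply_succAbove, zpow_zero, one_mul]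
    exact hrel r x hx
  · intro i x hx
    refine Fin.succAboveCases i₀ ?_ (fun i' => ?_) i
    · simp only [Fin.insertNth_apply_same, Int.cast_zero, mul_zero, Finset.sum_const_zero]
      exact hzero x (hCU hx)
    · simp only [Fin.insertNth_apply_succAbove]
      exact hhq i' x hx

/-- Exact twin of §22 (angle): dropping an angle index with vanishing coefficient. -/
theorem circleStructExact_dropAngle {n k l : ℕ} {U : Set (Fin n → ℝ)}
    {h W : Fin k → (Fin n → ℝ) → ℝ} {p u : Fin (l + 1) → (Fin n → ℝ) → ℝ} {g : (Fin n → ℝ) → ℝ}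
    (j₀ : Fin (l + 1)) (hzero : ∀ x ∈ U, p j₀ x = 0)
    (hred : CircleStructExactOn k l U h W (fun j => p (j₀.succAbove j)) (fun j => u (j₀.succAbove j)) g) :
    CircleStructExactOn k (l + 1) U h W p u g := by
  classical
  obtain ⟨N, C, hC, hdisj, hnull, hcell⟩ := hred
  refine ⟨N, C, hC, hdisj, hnull, fun c₀ => ?_⟩
  obtain ⟨hg0, R, f, q, S, f', q', hq, hrel, hhq, hq', hrel', hpq⟩ := hcell c₀
  have hCU : C c₀ ⊆ U := (hC c₀).2.2
  refine ⟨hg0, R, f, q, S, fun s => Fin.insertNth j₀ (0 : ℤ) (f' s), q', hq, hrel, hhq, hq', ?_, ?_⟩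
  · intro s x hx
    rw [Fin.sum_univ_succAbove _ j₀]
    simp only [Fin.insertNth_apply_same, Fin.insertNth_apply_succAbove, Int.cast_zero, zero_mul, zero_add]
    exact hrel' s x hx
  · intro j x hx
    refine Fin.succAboveCases j₀ ?_ (fun j' => ?_) j
    · simp only [Fin.insertNth_apply_same, Int.cast_zero, mul_zero, Finset.sum_const_zero]
      exact hzero x (hCU hx)
    · simp only [Fin.insertNth_apply_succAbove]
      exact hpq j' x hx

end G13

end Summit.KontsevichZagierPeriods.RootDecompRelativeModAbsolute.Rung30571.RegularisedLogLayer.CylLog.Leaf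

end
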